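import Summits.NavierStokesRegularity.NavierStokesRegularity.Theses.FilamentSkeletonRss
import Summits.NavierStokesRegularity.NavierStokesRegularity.Theorems.FilamentSkeletonRssClause13RRateColumnFloor

/-!
# Route `FilamentSkeletonRss` · crux `Clause13RNearStraightL` (stmt-NavierStokesRegularity-23612) · line `rate_bordered_split`

LINE-WRITER seat `linewriter-ns-filamentrss-1-g0` (planner), 2026-08-31.  HONEST FRAMING: clause 13-R of Variant A1L-R is a claim about the
linearisation of the normal-velocity map at a HYPOTHETICAL near-straight filament skeleton with rigid matched cores, on the NEGATIVE side of a
MODEL blow-up route; nothing in this file bears on Navier–Stokes regularity, which is NOT proved.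

## The line (architecture of record «13-J-type weighted coercivity BORDERED by the transversal rate row», typed in CLAUSE currency)

13-R asks, for every admissible test field `Y` and every `(dα, L)` with the BORDERED linearised defect `‖DT·Y − dα·R_j‖ ≤ L(1+|τ−c_j|)^a` on the
tangency ball (`R_j(τ) = P_n(e₃ × X_j(τ))` the rate column), BOTH the weighted bound `‖Y_j(τ)‖ ≤ cnd·L(1+|τ−c_j|)^b` AND the rate bound `|dα|√Γ ≤ cnd·L`.
The exponent `a` is the prover's choice and the rate column pins it to `a = 0` (`…Clause13RRateColumnFloor`, PR-1: on the ball `sup‖R_j‖ ≍ R_b√(Γ log Γ)`,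
so the `Y ≡ 0` instance is consistent for all large `Γ` iff `a = 0`).  With `a = 0` the clause is the composition of TWO genuine pieces and an
elementary envelope estimate, and this file proves the composition:

* STUB R · `stub_rateRow13RFlat : RateRow13RFlat` — THE RATE ROW (transversality of the rate column to the range of the linearised map on the
  clamped test class): a FLAT bordered defect on the ball forces `|dα|√Γ ≤ c_R·L`, for every envelope exponent `b`.  Mechanism foreseen (memo
  `CENSUS-23610-side-23612-g16.md` (m5), kit job `c13r_s0_29e43430a498`, `RESULTS-S0-rate-row-g14.md`): pair the defect against the affine annihilator
  `ψ = (τ−c_j)·(e₃ × X_j′)` of the local operator on the window `|τ − c_j| ≤ √Γ`, using the tilt floor `‖e₃ × X_j′(c_j)‖² ≥ θ₀(2−θ₀)`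
  (`norm_cross_single_two_sq_ge`) and near-straightness `R_b ≤ R_b₀(θ₀)`; the `Y`-leak through the window edge is lower order because the response
  exponent `b < 2`.  Size L.  Why it might fail: the leak term is controlled only through the joint bordered system (R is true iff the column is NOT
  approximately in the range of `DT` on ball-supported normal phase-orthogonal fields), so a window pairing alone may not close without J-type input.
* STUB J · `stub_clamped13JBordered : Clamped13JBordered` — THE CLAMPED WEIGHTED 13-J ESTIMATE WITH THE BORDERED ENVELOPE: a linearised defect bounded
  ON THE BALL by `L(1 + |τ−c_j|/√Γ)` (flat part + the slope-`L/√Γ` linear part that the removed rate column leaves behind, since `‖R_j(τ)‖ ≤ ‖X_j(τ)‖ ≤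
  R_w√Γ + |τ−c_j|`) forces `‖Y_j(τ)‖ ≤ c_J·L(1+|τ−c_j|)^b`.  This is where the MODEL layer lives (landed: `model_l2_estimate[_scaled]` p709153/p712385,
  `model_pointwise[_weighted[_small]]` p721438/p722938/p723999, exterior toolkit p731617/p732482/p733279/p734155) together with the still-untyped
  CLAUSE-level dictionary (c1) `DT ↔ model operator + remainders`, (c2) exactness of the in-ball coefficient from clause-9 tangency, (c3) flat → weighted
  conversion, (c4) `j`-bookkeeping (cross-filament terms `O(ρ⁻²Γ⁻¹)`), (c5) threading.  Size XL — THE HARDEST STUB.  Why it might fail: the exit/clamped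
  edge mode (E∞ of memo `DESIGN-23612-currency-b-edge-lane-g19.md`) must be paid in the weighted currency at the ball edge `|τ−c_j| ≍ R_b√(Γ log Γ)`, and the
  slope term grows to `L·R_b√(log Γ)/c_g` there.  J implies the sibling (aside) crux `Clause13NearStraightL` (stmt-23321) — proved below — and is
  STRICTLY SHARPER than it (ball-only hypothesis, bordered envelope); it does NOT imply 13-R (no control of `dα`).
* GLUE (proved here, no `sorry`): the column envelope `‖dα·R_j(τ)‖ ≤ |dα|(R_w√Γ + |τ−c_j|) ≤ c_R L R_w + c_R L|τ−c_j|/√Γ` (unit speed + waist clause 9 +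
  `norm_sub_inner_smul_le` + `norm_cross_single_two_le` + STUB R), the triangle inequality, STUB J at `L′ = L(1 + c_R R_w + c_R)`, and the constants
  `Rb₀ := min`, `a := 0`, `cnd := max c_R (c_J(1 + c_R R_w + c_R))`, `Γ₀ := max Γ_J (max Γ_R 1)`.

Neither stub restates the crux: R has no `Y`-conclusion, J has no rate column; 13-R needs both (checked: `cruxGoal13R_of_stubs` below uses each).
Corollaries proved here for the sibling item stmt-NavierStokesRegularity-23321 (`Clause13NearStraightL`, aside): `siblingGoal13J_of_clamped13J :
Clamped13JBordered → Clause13NearStraightL` and `Clause13NearStraightL_of_13R : Clause13RNearStraightL → Clause13NearStraightL` (take `dα := 0`); the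
hypothesis-carrying versions conclude local ALIASES (`CruxGoal13R`, `SiblingGoal13J`) so that exactly one theorem concludes each item by name.
-/

set_option linter.dupNamespace false
set_option linter.unusedVariables false

noncomputable section

namespace Summit.NavierStokesRegularity.NavierStokesRegularity.Cruxes.Clause13RNearStraightL.RateBorderedSplit

open Set Function Filter MeasureTheory Real
open Literature.Analysis.FluidPDE
open Summit.NavierStokesRegularity.NavierStokesRegularity.Theorems.MatchedKernel (norm_sub_inner_smul_le norm_cross_single_two_le)
open scoped InnerProductSpace Topology BigOperators

/-! ## §1 The two stub STATEMENTS (clause currency: the crux text verbatim up to the quantifier prefix over `(a, b, cnd, Γ₀)` and the tail) -/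

/-- STUB R statement · the RATE ROW with a FLAT bordered defect: same skeleton hypotheses, same near-straight class, same test class as the crux;
prefix `∀ b, ∃ (cnd Γ₀)` (every envelope exponent, its own constant), tail `(∀ j τ, in-ball → ‖DT·Y − dα·R_j‖ ≤ L) → |dα|√Γ ≤ cnd·L`.
(route-posited candidate statement; not a Literature fact) -/
def RateRow13RFlat : Prop :=
  (open Literature.Analysis.FluidPDE in ∀ (N : ℕ) (δ ρ K Λ Rw cg θ₀ KA : ℝ), 0 < N → 0 < δ → 0 < ρ → 0 < Rw → 0 < cg → 0 < θ₀ → ∃ Rb₀ : ℝ, 0 < Rb₀ ∧ ∀ Rb : ℝ, 0 < Rb → Rb ≤ Rb₀ → ∀ b : ℝ, ∃ (cnd Γ₀ : ℝ), 0 < cnd ∧ ∀ Γ : ℝ, Γ₀ ≤ Γ → ∀ (γ : Fin N → ℝ) (α : ℝ) (X : Fin N → ℝ → EuclideanSpace ℝ (Fin 3)) (w : Fin N → ℝ → ℝ) (c : Fin N → ℝ) (Aa : Fin N → ℝ → ℝ), (∀ (u:(Fin N → ℝ → EuclideanSpace ℝ (Fin 3)) → EuclideanSpace ℝ (Fin 3)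 → EuclideanSpace ℝ (Fin 3)) (v:EuclideanSpace ℝ (Fin 3) → EuclideanSpace ℝ (Fin 3)) (A:Fin N → (EuclideanSpace ℝ (Fin 3) →L[ℝ] EuclideanSpace ℝ (Fin 3))) (T:(Fin N → ℝ → EuclideanSpace ℝ (Fin 3)) → Fin N → ℝ → EuclideanSpace ℝ (Fin 3)), (∀ Z y, u Z y = ∑ k, (Γ*γ k/(4*Real.pi))•∫ σ:ℝ, ((‖y-Z k σ‖^2+Real.exp (-(1+Real.eulerMascheroniConstant-Real.log 2))*Aa k σ)^(3/2:ℝ))⁻¹•cross (deriv (Z k) σ) (y-Z k σ))→(∀ y, v y = u X y+(1/2:ℝ)•y-α•cross (EuclideanSpace.single 2 1) y)→(∀ j, A j = fderiv ℝ v (X j (c j)))→(∀ Z j τ, T Z j τ = (u Z (Z j τ)+(1/2:ℝ)•Z j τ-α•cross (EuclideanSpace.single 2 1) (Z j τ))-(⟪u Z (Z j τ)+(1/2:ℝ)•Z j τ-α•cross (EuclideanSpace.single 2 1) (Z j τ), deriv (Z j) τ⟫_ℝ/‖deriv (Z j) τ‖^2)•deriv (Z j) τ)→(α ≠ 0 ∧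 (∀ j, γ j ≠ 0) ∧ (∀ j, ContDiff ℝ 2 (X j) ∧ Differentiable ℝ (w j)∧(∀ τ, ‖deriv (X j) τ‖ = 1)∧(∀ τ, ‖iteratedDeriv 2 (X j) τ‖*√Γ≤K) ∧ Tendsto (fun τ => ‖X j τ‖) (cocompact ℝ) atTop) ∧ (∀ j k, j ≠ k → ∀ τ σ, ρ*√Γ≤‖X j τ-X k σ‖) ∧ (∀ j τ σ, ρ*√Γ≤|τ-σ| → cg*ρ*√Γ≤‖X j τ-X j σ‖) ∧ (∀ j τ, cg*|τ-c j|≤Rw*√Γ+‖X j τ‖) ∧ (∀ j τ, w j τ = ⟪v (X j τ), deriv (X j) τ⟫_ℝ) ∧ (∀ j τ, ‖X j τ‖≤Rb*√(Γ*Real.log Γ) → v (X j τ) = w j τ•deriv (X j) τ) ∧ (∀ j, ‖X j (c j)‖≤Rw*√Γ) ∧ (∀ j, |⟪deriv (X j) (c j), EuclideanSpace.single 2 1⟫_ℝ|≤1-θ₀) ∧ (θ₀≤|α| ∧ |α|≤θ₀⁻¹ ∧ ∀ j, θ₀≤|γ j| ∧ |γ j|≤θ₀⁻¹) ∧ (∀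 j, w j (c j) = 0 ∧ (∀ τ, w j τ = 0 → τ = c j) ∧ 3/2+δ≤deriv (w j) (c j) ∧ deriv (w j) (c j)≤Λ) ∧ (∀ j, Differentiable ℝ (Aa j) ∧ (∀ τ, 0 < Aa j τ) ∧ 1≤KA*Aa j (c j) ∧ ∀ τ, ‖X j τ‖≤2*Rb*√(Γ*Real.log Γ) → Aa j τ = Aa j (c j)) ∧ (∀ j τ, Rw^2*Γ*Aa j τ≤KA*(Rw^2*Γ+‖X j τ‖^2)))) → ((∀ j τ σ, ‖deriv (X j) τ - deriv (X j) σ‖ ≤ Rb) ∧ (∀ j τ, |deriv (w j) τ| ≤ Λ) ∧ (∀ j τ, Λ⁻¹ ≤ Aa j τ)) → (∀ (u:(Fin N → ℝ → EuclideanSpace ℝ (Fin 3)) → EuclideanSpace ℝ (Fin 3) → EuclideanSpace ℝ (Fin 3)) (v:EuclideanSpace ℝ (Fin 3) → EuclideanSpace ℝ (Fin 3)) (A:Fin N → (EuclideanSpace ℝ (Fin 3) →L[ℝ] EuclideanSpace ℝ (Fin 3))) (T:(Fin N → ℝ → EuclideanSpace ℝ (Fin 3)) → Fin N → ℝ → EuclideanSpace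 ℝ (Fin 3)), (∀ Z y, u Z y = ∑ k, (Γ*γ k/(4*Real.pi))•∫ σ:ℝ, ((‖y-Z k σ‖^2+Real.exp (-(1+Real.eulerMascheroniConstant-Real.log 2))*Aa k σ)^(3/2:ℝ))⁻¹•cross (deriv (Z k) σ) (y-Z k σ))→(∀ y, v y = u X y+(1/2:ℝ)•y-α•cross (EuclideanSpace.single 2 1) y)→(∀ j, A j = fderiv ℝ v (X j (c j)))→(∀ Z j τ, T Z j τ = (u Z (Z j τ)+(1/2:ℝ)•Z j τ-α•cross (EuclideanSpace.single 2 1) (Z j τ))-(⟪u Z (Z j τ)+(1/2:ℝ)•Z j τ-α•cross (EuclideanSpace.single 2 1) (Z j τ), deriv (Z j) τ⟫_ℝ/‖deriv (Z j) τ‖^2)•deriv (Z j) τ)→(∀ Y:Fin N → ℝ → EuclideanSpace ℝ (Fin 3), (∀ j, ContDiff ℝ 2 (Y j))→(∀ j τ, ⟪Y j τ, deriv (X j) τ⟫_ℝ = 0) → (∀ j τ, Rb*√(Γ*Real.log Γ) < ‖X j τ‖ → Y j τ = 0) → ∑ j, ⟪Y j (c j), cross (EuclideanSpace.single 2 1)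 (X j (c j))⟫_ℝ = 0 → (∀ j τ, ‖Y j τ‖+‖deriv (Y j) τ‖+‖iteratedDeriv 2 (Y j) τ‖≤(1+|τ-c j|)^b) → ∀ dα L:ℝ, (∀ j τ, ‖X j τ‖≤Rb*√(Γ*Real.log Γ) → ‖deriv (fun s:ℝ => T (fun k σ => X k σ+s•Y k σ) j τ) 0-dα•(cross (EuclideanSpace.single 2 1) (X j τ)-⟪cross (EuclideanSpace.single 2 1) (X j τ), deriv (X j) τ⟫_ℝ•deriv (X j) τ)‖≤L) → |dα| * √Γ≤cnd*L)))

/-- STUB J statement · the CLAMPED weighted 13-J estimate with the BORDERED forcing envelope: same hypotheses and test class as the crux; prefix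
`∃ (b cnd Γ₀)`, tail `(∀ j τ, in-ball → ‖DT·Y‖ ≤ L(1 + |τ−c_j|/√Γ)) → ∀ j τ, ‖Y_j τ‖ ≤ cnd·L(1+|τ−c_j|)^b`.
(route-posited candidate statement; not a Literature fact) -/
def Clamped13JBordered : Prop :=
  (open Literature.Analysis.FluidPDE in ∀ (N : ℕ) (δ ρ K Λ Rw cg θ₀ KA : ℝ), 0 < N → 0 < δ → 0 < ρ → 0 < Rw → 0 < cg → 0 < θ₀ → ∃ Rb₀ : ℝ, 0 < Rb₀ ∧ ∀ Rb : ℝ, 0 < Rb → Rb ≤ Rb₀ → ∃ (b cnd Γ₀ : ℝ), 0 < cnd ∧ ∀ Γ : ℝ, Γ₀ ≤ Γ → ∀ (γ : Fin N → ℝ) (α : ℝ) (X : Fin N → ℝ → EuclideanSpace ℝ (Fin 3)) (w : Fin N → ℝ → ℝ) (c : Fin N → ℝ) (Aa : Fin N → ℝ → ℝ), (∀ (u:(Fin N → ℝ → EuclideanSpace ℝ (Fin 3)) → EuclideanSpace ℝ (Fin 3) → EuclideanSpace ℝ (Fin 3)) (v:EuclideanSpace ℝ (Fin 3) → EuclideanSpace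 ℝ (Fin 3)) (A:Fin N → (EuclideanSpace ℝ (Fin 3) →L[ℝ] EuclideanSpace ℝ (Fin 3))) (T:(Fin N → ℝ → EuclideanSpace ℝ (Fin 3)) → Fin N → ℝ → EuclideanSpace ℝ (Fin 3)), (∀ Z y, u Z y = ∑ k, (Γ*γ k/(4*Real.pi))•∫ σ:ℝ, ((‖y-Z k σ‖^2+Real.exp (-(1+Real.eulerMascheroniConstant-Real.log 2))*Aa k σ)^(3/2:ℝ))⁻¹•cross (deriv (Z k) σ) (y-Z k σ))→(∀ y, v y = u X y+(1/2:ℝ)•y-α•cross (EuclideanSpace.single 2 1) y)→(∀ j, A j = fderiv ℝ v (X j (c j)))→(∀ Z j τ, T Z j τ = (u Z (Z j τ)+(1/2:ℝ)•Z j τ-α•cross (EuclideanSpace.single 2 1) (Z j τ))-(⟪u Z (Z j τ)+(1/2:ℝ)•Z j τ-α•cross (EuclideanSpace.single 2 1) (Z j τ), deriv (Z j) τ⟫_ℝ/‖deriv (Z j) τ‖^2)•deriv (Z j) τ)→(α ≠ 0 ∧ (∀ j, γ j ≠ 0) ∧ (∀ j, ContDiff ℝ 2 (X j) ∧ Differentiable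 ℝ (w j)∧(∀ τ, ‖deriv (X j) τ‖ = 1)∧(∀ τ, ‖iteratedDeriv 2 (X j) τ‖*√Γ≤K) ∧ Tendsto (fun τ => ‖X j τ‖) (cocompact ℝ) atTop) ∧ (∀ j k, j ≠ k → ∀ τ σ, ρ*√Γ≤‖X j τ-X k σ‖) ∧ (∀ j τ σ, ρ*√Γ≤|τ-σ| → cg*ρ*√Γ≤‖X j τ-X j σ‖) ∧ (∀ j τ, cg*|τ-c j|≤Rw*√Γ+‖X j τ‖) ∧ (∀ j τ, w j τ = ⟪v (X j τ), deriv (X j) τ⟫_ℝ) ∧ (∀ j τ, ‖X j τ‖≤Rb*√(Γ*Real.log Γ) → v (X j τ) = w j τ•deriv (X j) τ) ∧ (∀ j, ‖X j (c j)‖≤Rw*√Γ) ∧ (∀ j, |⟪deriv (X j) (c j), EuclideanSpace.single 2 1⟫_ℝ|≤1-θ₀) ∧ (θ₀≤|α| ∧ |α|≤θ₀⁻¹ ∧ ∀ j, θ₀≤|γ j| ∧ |γ j|≤θ₀⁻¹) ∧ (∀ j, w j (c j) = 0 ∧ (∀ τ, w j τ = 0 → τ = c j) ∧ 3/2+δ≤deriv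 (w j) (c j) ∧ deriv (w j) (c j)≤Λ) ∧ (∀ j, Differentiable ℝ (Aa j) ∧ (∀ τ, 0 < Aa j τ) ∧ 1≤KA*Aa j (c j) ∧ ∀ τ, ‖X j τ‖≤2*Rb*√(Γ*Real.log Γ) → Aa j τ = Aa j (c j)) ∧ (∀ j τ, Rw^2*Γ*Aa j τ≤KA*(Rw^2*Γ+‖X j τ‖^2)))) → ((∀ j τ σ, ‖deriv (X j) τ - deriv (X j) σ‖ ≤ Rb) ∧ (∀ j τ, |deriv (w j) τ| ≤ Λ) ∧ (∀ j τ, Λ⁻¹ ≤ Aa j τ)) → (∀ (u:(Fin N → ℝ → EuclideanSpace ℝ (Fin 3)) → EuclideanSpace ℝ (Fin 3) → EuclideanSpace ℝ (Fin 3)) (v:EuclideanSpace ℝ (Fin 3) → EuclideanSpace ℝ (Fin 3)) (A:Fin N → (EuclideanSpace ℝ (Fin 3) →L[ℝ] EuclideanSpace ℝ (Fin 3))) (T:(Fin N → ℝ → EuclideanSpace ℝ (Fin 3)) → Fin N → ℝ → EuclideanSpace ℝ (Fin 3)), (∀ Z y, u Z y = ∑ k, (Γ*γ k/(4*Real.pi))•∫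 σ:ℝ, ((‖y-Z k σ‖^2+Real.exp (-(1+Real.eulerMascheroniConstant-Real.log 2))*Aa k σ)^(3/2:ℝ))⁻¹•cross (deriv (Z k) σ) (y-Z k σ))→(∀ y, v y = u X y+(1/2:ℝ)•y-α•cross (EuclideanSpace.single 2 1) y)→(∀ j, A j = fderiv ℝ v (X j (c j)))→(∀ Z j τ, T Z j τ = (u Z (Z j τ)+(1/2:ℝ)•Z j τ-α•cross (EuclideanSpace.single 2 1) (Z j τ))-(⟪u Z (Z j τ)+(1/2:ℝ)•Z j τ-α•cross (EuclideanSpace.single 2 1) (Z j τ), deriv (Z j) τ⟫_ℝ/‖deriv (Z j) τ‖^2)•deriv (Z j) τ)→(∀ Y:Fin N → ℝ → EuclideanSpace ℝ (Fin 3), (∀ j, ContDiff ℝ 2 (Y j))→(∀ j τ, ⟪Y j τ, deriv (X j) τ⟫_ℝ = 0) → (∀ j τ, Rb*√(Γ*Real.log Γ) < ‖X j τ‖ → Y j τ = 0) → ∑ j, ⟪Y j (c j), cross (EuclideanSpace.single 2 1) (X j (c j))⟫_ℝ = 0 → (∀ j τ, ‖Y j τ‖+‖deriv (Y j) τ‖+‖iteratedDeriv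 2 (Y j) τ‖≤(1+|τ-c j|)^b) → ∀ L:ℝ, (∀ j τ, ‖X j τ‖≤Rb*√(Γ*Real.log Γ) → ‖deriv (fun s:ℝ => T (fun k σ => X k σ+s•Y k σ) j τ) 0‖≤L*(1+|τ-c j|/√Γ)) → ∀ j τ, ‖Y j τ‖≤cnd*L*(1+|τ-c j|)^b)))

/-- Local ALIAS of the crux (so that the hypothesis-carrying composition below does not itself conclude the crux by name; the by-name theorem
`Clause13RNearStraightL_of` is the unique skeleton theorem). -/
def CruxGoal13R : Prop := Summit.NavierStokesRegularity.NavierStokesRegularity.Theses.FilamentSkeletonRss.Clause13RNearStraightL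

/-- Local ALIAS of the sibling item `Clause13NearStraightL` (stmt-23321), same purpose. -/
def SiblingGoal13J : Prop := Summit.NavierStokesRegularity.NavierStokesRegularity.Theses.FilamentSkeletonRss.Clause13NearStraightL

/-! ## §2 The stubs (the ONLY `sorry`s of this file) -/

/-- STUB R · `stub_rateRow13RFlat` · L · the rate row: a flat bordered linearised defect on the tangency ball forces `|dα|√Γ ≤ c_R L`
(affine-annihilator pairing on the window `|τ−c_j| ≤ √Γ`, tilt floor `θ₀(2−θ₀)`, near-straightness; memo CENSUS-23610-side-23612-g16 (m5),
kit `c13r_s0_29e43430a498`). -/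
theorem stub_rateRow13RFlat : RateRow13RFlat := by
  sorry

/-- STUB J · `stub_clamped13JBordered` · XL · THE HARDEST: the clamped weighted 13-J estimate with forcing envelope `L(1+|τ−c_j|/√Γ)` on the ball
(MODEL layer landed p709153…p734155; CLAUSE dictionary c1–c5 of memo CENSUS-23610-side-23612-g16 §2 not yet typed). -/
theorem stub_clamped13JBordered : Clamped13JBordered := by
  sorry

/-! ## §3 Glue lemmas (real proofs) -/

/-- Unit-speed envelope: `‖X τ‖ ≤ ‖X c‖ + |τ − c|`. [folklore] -/
theorem norm_le_norm_waist_add {X : ℝ → EuclideanSpace ℝ (Fin 3)} (hX : ContDiff ℝ 2 X) (hunit : ∀ σ, ‖deriv X σ‖ = 1)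
    (c τ : ℝ) : ‖X τ‖ ≤ ‖X c‖ + |τ - c| := by
  have hXd : Differentiable ℝ X := hX.differentiable (by norm_num)
  have h := Convex.norm_image_sub_le_of_norm_deriv_le (f := X) (C := 1) (fun r _ => hXd r)
    (fun r _ => (hunit r).le) convex_univ (Set.mem_univ c) (Set.mem_univ τ)
  rw [one_mul, Real.norm_eq_abs] at h
  have hsplit : X c + (X τ - X c) = X τ := by abel
  calc ‖X τ‖ = ‖X c + (X τ - X c)‖ := by rw [hsplit]
    _ ≤ ‖X c‖ + ‖X τ - X c‖ := norm_add_le _ _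
    _ ≤ ‖X c‖ + |τ - c| := by linarith

/-- The rate column is dominated by the position: `‖e₃ × x − ⟪e₃ × x, t⟫t‖ ≤ ‖x‖` for a unit `t`. [folklore] -/
theorem norm_rateColumn_le (x t : EuclideanSpace ℝ (Fin 3)) (ht : ‖t‖ = 1) :
    ‖cross (EuclideanSpace.single 2 1) x - ⟪cross (EuclideanSpace.single 2 1) x, t⟫_ℝ • t‖ ≤ ‖x‖ :=
  le_trans (norm_sub_inner_smul_le _ _ ht) (norm_cross_single_two_le x)

/-- Bordered triangle inequality: `‖D‖ ≤ L + |dα|·‖P‖` from `‖D − dα·P‖ ≤ L`. [folklore] -/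
theorem norm_le_of_bordered {D P : EuclideanSpace ℝ (Fin 3)} {dα L : ℝ} (h : ‖D - dα • P‖ ≤ L) : ‖D‖ ≤ L + |dα| * ‖P‖ := by
  calc ‖D‖ = ‖(D - dα • P) + dα • P‖ := by rw [sub_add_cancel]
    _ ≤ ‖D - dα • P‖ + ‖dα • P‖ := norm_add_le _ _
    _ ≤ L + |dα| * ‖P‖ := by rw [norm_smul, Real.norm_eq_abs]; exact add_le_add h le_rfl

/-- The arithmetic of the envelope: `L + |dα|‖P‖ ≤ L(1 + c_R R_w + c_R)(1 + t/√Γ)` once `|dα|√Γ ≤ c_R L`, `‖P‖ ≤ R_w√Γ + t`, `1 ≤ √Γ`. [folklore] -/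
theorem envelope_arith {L dα cR Rw nP t s : ℝ} (hcR : 0 < cR) (hRw : 0 < Rw) (hs : 1 ≤ s) (ht : 0 ≤ t) (hnP : 0 ≤ nP)
    (hrate : |dα| * s ≤ cR * L) (hP : nP ≤ Rw * s + t) :
    L + |dα| * nP ≤ (L * (1 + cR * Rw + cR)) * (1 + t / s) := by
  have hs0 : 0 < s := lt_of_lt_of_le one_pos hs
  have hL : 0 ≤ L := by
    have h0 : 0 ≤ cR * L := le_trans (mul_nonneg (abs_nonneg _) hs0.le) hrate
    exact (mul_nonneg_iff_of_pos_left hcR).1 h0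
  have hdα : |dα| ≤ cR * L / s := by rw [le_div_iff₀ hs0]; exact hrate
  have h1 : |dα| * nP ≤ (cR * L / s) * (Rw * s + t) :=
    mul_le_mul hdα hP hnP (div_nonneg (mul_nonneg hcR.le hL) hs0.le)
  have h2 : (cR * L / s) * (Rw * s + t) = cR * L * Rw + cR * L * (t / s) := by
    field_simp
  have hts : 0 ≤ t / s := div_nonneg ht hs0.le
  nlinarith [h1, h2, hts, mul_nonneg hL hts, mul_nonneg (mul_nonneg hL hcR.le) (mul_nonneg hRw.le hts), mul_nonneg hL hcR.le]

/-! ## §4 COMPOSITION — the crux `FilamentSkeletonRss.Clause13RNearStraightL` (stmt-NavierStokesRegularity-23612) BY NAME -/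

/-- **THE SKELETON THEOREM.**  13-R from the rate row (R) and the clamped bordered 13-J estimate (J): `Rb₀ := min`, `a := 0`, `b := b_J`,
`cnd := max c_R (c_J(1 + c_R R_w + c_R))`, `Γ₀ := max Γ_J (max Γ_R 1)`; the column envelope uses unit speed (clause 3) and the waist clause 9.
Real proof; closed modulo the two stub `sorry`s only. -/
theorem cruxGoal13R_of_stubs (hR : RateRow13RFlat) (hJ : Clamped13JBordered) : CruxGoal13R := by
  intro N δ ρ K Λ Rw cg θ₀ KA hN hδ hρ hRw hcg hθ₀
  obtain ⟨RbR, hRbR, hRfam⟩ := hR N δ ρ K Λ Rw cg θ₀ KA hN hδ hρ hRw hcg hθ₀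
  obtain ⟨RbJ, hRbJ, hJfam⟩ := hJ N δ ρ K Λ Rw cg θ₀ KA hN hδ hρ hRw hcg hθ₀
  refine ⟨min RbR RbJ, lt_min hRbR hRbJ, fun Rb hRb hRb₀ => ?_⟩
  obtain ⟨b, cJ, ΓJ, hcJ, hJΓ⟩ := hJfam Rb hRb (le_trans hRb₀ (min_le_right _ _))
  obtain ⟨cR, ΓR, hcR, hRΓ⟩ := hRfam Rb hRb (le_trans hRb₀ (min_le_left _ _)) b
  refine ⟨0, b, max cR (cJ * (1 + cR * Rw + cR)), max ΓJ (max ΓR 1), le_rfl, lt_max_iff.2 (Or.inl hcR), fun Γ hΓ => ?_⟩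
  have hΓJ : ΓJ ≤ Γ := le_trans (le_max_left _ _) hΓ
  have hΓR : ΓR ≤ Γ := le_trans (le_trans (le_max_left _ _) (le_max_right _ _)) hΓ
  have hΓ1 : (1:ℝ) ≤ Γ := le_trans (le_trans (le_max_right _ _) (le_max_right _ _)) hΓ
  have hs : (1:ℝ) ≤ √Γ := by simpa using Real.sqrt_le_sqrt hΓ1
  intro γ α X w c Aa hH hNS u v A T hu hv hA hT Y hY2 hYn hYoff hYph hYenv dα L hdef
  have hrate : |dα| * √Γ ≤ cR * L :=
    hRΓ Γ hΓR γ α X w c Aa hH hNS u v A T hu hv hA hT Y hY2 hYn hYoff hYph hYenv dα L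
      (fun j τ hin => by simpa using hdef j τ hin)
  have hL : 0 ≤ L := by
    have h0 : 0 ≤ cR * L := le_trans (mul_nonneg (abs_nonneg _) (Real.sqrt_nonneg _)) hrate
    exact (mul_nonneg_iff_of_pos_left hcR).1 h0
  obtain ⟨-, -, h3, -, -, -, -, -, h9, -⟩ := hH u v A T hu hv hA hT
  have key : ∀ j τ, ‖X j τ‖ ≤ Rb * √(Γ * Real.log Γ) →
      ‖deriv (fun s:ℝ => T (fun k σ => X k σ + s • Y k σ) j τ) 0‖ ≤ (L * (1 + cR * Rw + cR)) * (1 + |τ - c j| / √Γ) := by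
    intro j τ hin
    have hunit : ∀ σ, ‖deriv (X j) σ‖ = 1 := (h3 j).2.2.1
    have hXn : ‖X j τ‖ ≤ Rw * √Γ + |τ - c j| :=
      le_trans (norm_le_norm_waist_add (h3 j).1 hunit (c j) τ) (add_le_add (h9 j) le_rfl)
    have hPn := le_trans (norm_rateColumn_le (X j τ) (deriv (X j) τ) (hunit τ)) hXn
    exact le_trans (norm_le_of_bordered (hdef j τ hin |>.trans (by simp)))
      (envelope_arith hcR hRw hs (abs_nonneg _) (norm_nonneg _) hrate hPn)
  have hYJ := hJΓ Γ hΓJ γ α X w c Aa hH hNS u v A T hu hv hA hT Y hY2 hYn hYoff hYph hYenv (L * (1 + cR * Rw + cR)) key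
  refine ⟨fun j τ => ?_, le_trans hrate (mul_le_mul_of_nonneg_right (le_max_left _ _) hL)⟩
  have hpow : 0 ≤ (1 + |τ - c j|) ^ b := Real.rpow_nonneg (by positivity) b
  calc ‖Y j τ‖ ≤ cJ * (L * (1 + cR * Rw + cR)) * (1 + |τ - c j|) ^ b := hYJ j τ
    _ = (cJ * (1 + cR * Rw + cR)) * L * (1 + |τ - c j|) ^ b := by ring
    _ ≤ max cR (cJ * (1 + cR * Rw + cR)) * L * (1 + |τ - c j|) ^ b :=
        mul_le_mul_of_nonneg_right (mul_le_mul_of_nonneg_right (le_max_right _ _) hL) hpow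

/-- The crux by name from the two stub constants (the registered skeleton's concluding theorem). -/
theorem Clause13RNearStraightL_of : Summit.NavierStokesRegularity.NavierStokesRegularity.Theses.FilamentSkeletonRss.Clause13RNearStraightL :=
  cruxGoal13R_of_stubs stub_rateRow13RFlat stub_clamped13JBordered

/-! ## §5 Corollaries for the sibling item `Clause13NearStraightL` (stmt-NavierStokesRegularity-23321, aside) — real proofs -/

/-- STUB J alone implies the (unclamped, rate-free) sibling clause 13-J of Variant A1L: take `a := 0`; an all-`τ` flat defect bound is in particular a
ball bound under the bordered envelope. -/
theorem siblingGoal13J_of_clamped13J (hJ : Clamped13JBordered) : SiblingGoal13J := by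
  intro N δ ρ K Λ Rw cg θ₀ KA hN hδ hρ hRw hcg hθ₀
  obtain ⟨RbJ, hRbJ, hJfam⟩ := hJ N δ ρ K Λ Rw cg θ₀ KA hN hδ hρ hRw hcg hθ₀
  refine ⟨RbJ, hRbJ, fun Rb hRb hRb₀ => ?_⟩
  obtain ⟨b, cJ, ΓJ, hcJ, hJΓ⟩ := hJfam Rb hRb hRb₀
  refine ⟨0, b, cJ, ΓJ, le_rfl, hcJ, fun Γ hΓ => ?_⟩
  intro γ α X w c Aa hH hNS u v A T hu hv hA hT Y hY2 hYn hYoff hYph hYenv L hdef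
  have hL : 0 ≤ L := by
    have h := hdef ⟨0, hN⟩ 0
    simp only [Real.rpow_zero, mul_one] at h
    exact (norm_nonneg _).trans h
  exact hJΓ Γ hΓ γ α X w c Aa hH hNS u v A T hu hv hA hT Y hY2 hYn hYoff hYph hYenv L (fun j τ _ => by
    have h := hdef j τ
    simp only [Real.rpow_zero, mul_one] at h
    have hq : 0 ≤ |τ - c j| / √Γ := div_nonneg (abs_nonneg _) (Real.sqrt_nonneg _)
    exact h.trans (le_mul_of_one_le_right hL (by linarith)))

/-- The live leaf 13-R implies the sibling 13-J clause (`dα := 0`). -/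
theorem siblingGoal13J_of_clause13R (h13R : Summit.NavierStokesRegularity.NavierStokesRegularity.Theses.FilamentSkeletonRss.Clause13RNearStraightL) : SiblingGoal13J := by
  intro N δ ρ K Λ Rw cg θ₀ KA hN hδ hρ hRw hcg hθ₀
  obtain ⟨Rb₀, hRb₀, hfam⟩ := h13R N δ ρ K Λ Rw cg θ₀ KA hN hδ hρ hRw hcg hθ₀
  refine ⟨Rb₀, hRb₀, fun Rb hRb hRble => ?_⟩
  obtain ⟨a, b, cnd, Γ₀, ha, hcnd, hΓfam⟩ := hfam Rb hRb hRble
  refine ⟨a, b, cnd, Γ₀, ha, hcnd, fun Γ hΓ => ?_⟩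
  intro γ α X w c Aa hH hNS u v A T hu hv hA hT Y hY2 hYn hYoff hYph hYenv L hdef
  exact (hΓfam Γ hΓ γ α X w c Aa hH hNS u v A T hu hv hA hT Y hY2 hYn hYoff hYph hYenv 0 L
    (fun j τ _ => by simpa using hdef j τ)).1

/-- Hence the sibling item from the two stubs as well (for the record; its honest line is STUB J alone). -/
theorem Clause13NearStraightL_of : Summit.NavierStokesRegularity.NavierStokesRegularity.Theses.FilamentSkeletonRss.Clause13NearStraightL :=
  siblingGoal13J_of_clamped13J stub_clamped13JBordered

/-- … and from the live leaf 13-R by name (real implication between the two route items, through the alias). -/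
theorem Clause13NearStraightL_of_13R : Summit.NavierStokesRegularity.NavierStokesRegularity.Theses.FilamentSkeletonRss.Clause13RNearStraightL → Summit.NavierStokesRegularity.NavierStokesRegularity.Theses.FilamentSkeletonRss.Clause13NearStraightL :=
  fun h => siblingGoal13J_of_clause13R h

end Summit.NavierStokesRegularity.NavierStokesRegularity.Cruxes.Clause13RNearStraightL.RateBorderedSplit

end
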